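import Summits.NavierStokesRegularity.FluidComputer.ForcedContinuationPieces
import Summits.NavierStokesRegularity.FluidComputer.PalasekTowerRegisterGlobalEnvelopeAt
import Literature.Analysis.FluidPDE.ClassicalContinuationAPriori
import Literature.Analysis.FluidPDE.ClassicalSolutionGlueIcc
import Literature.Analysis.FluidPDE.TaoH1LocalExistenceForced
import HarnessLib

/-!
# Crossing the end of a forced era, II: a BOUNDED classical finite-energy solution of the FORCED
# Navier–Stokes system on a closed slab continues classically past the slab — and the stub
# `LocalContinuationAt k` of the E–C route holds at EVERY level — given Tao's forced local theory

Cell `ns-blowup`, seat `ns-blowup-ecbridge-1` (g5). LABEL: E–C typing + kernel analysis. WHAT THIS IS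
NOT: not Navier–Stokes evidence — a CONDITIONAL continuation theorem (one named fact,
`Literature.Analysis.FluidPDE.tao2011_smooth_local_existence_forced` = Tao 2013 Thm. 5.4 (ii)+(iv)
WITH forcing, the forced twin of the discharged `tao2011_smooth_local_existence`) and its corollary
for registered stages; no stage, flow or tower is constructed, nothing about the physics stubs
(`AprioriCeilingAt`, `ReadoutFloorsAt`).

* `ForcedContinuation.exists_forced_continuation_of_bounded` — `ν > 0`, Clay-class force `f`,
  `(u, p)` classical on `[0, τ]` with finite energy, `‖u‖ ≤ M` and Schwartz datum `u 0`: there are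
  `T' > τ` and a classical `(U, P)` on `[0, T']` with the same force, finite energy, `U = u` and
  `P = p` on `[0, τ]`. RESTART LOOP (pieces in `ForcedContinuationPieces`): pieces from the `H^∞`
  slices `u(n h/2)` with the uniform lifespan `h = min(τ, 1, cν³/(A + B + 1)⁴)`, `A² = E₀ + K*`
  (`E₀` the energy bound, `K*` the uniform enstrophy bound of the loop), `B` the force's `H¹` size;
  the first piece reaching past `τ` (a `Nat.find`) is identified with the flow on `[t_N, τ]`, its
  pressure gauge matched (`IsClassicalNSSolutionOn.exists_pressure_eq_on_Icc`), shifted back and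
  glued (`IsClassicalNSSolutionOn.glue_Icc`).
* `Stage.exists_forced_continuation` — every stage (any `ν > 0`, rates, schedule, margins, level)
  continues under the design force past its slab: the stage carries its own ceiling `c₂ Y_k`, the
  schedule its Clay force and Schwartz datum.
* `localContinuationAt_of_forced_local_existence : tao2011_smooth_local_existence_forced →
  LocalContinuationAt k` for EVERY `k` (ecbridge-7's stub, open in the tree at `k ≤ 1`), and the
  consequences by name: `continuationEnvelopeAt_of_forced_apriori` (the upper half at `k ≥ 1` is
  the no-overshoot bet alone) and `heredityAtOne_of_forced_apriori_floors`
  (`HeredityAtOne ⇐ F2 ∧ AprioriCeilingAt 1 ∧ ReadoutFloorsAt 1`).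

References: T. Tao, Anal. PDE 6 (2013), Thm. 5.4 [cite: Tao2011, Thm. 5.4 (ii)+(iv)];
J. C. Robinson, J. L. Rodrigo, W. Sadowski, *The Three-Dimensional Navier–Stokes Equations* (2016),
§8.1 (restart–identify–glue) [cite: RobinsonRodrigoSadowski2016, Thm. 8.17];
S. Palasek, arXiv:2605.13827 §4 [cite: Palasek2026ElementaryModel, §4].
-/

noncomputable section

open MeasureTheory Set Function Filter Topology
open scoped ENNReal NNReal ContDiff

namespace Summit.NavierStokesRegularity.FluidComputer.PalasekTowerClayBridge

open Literature.Analysis.FluidPDE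

namespace ForcedContinuation

/-- The energy of a field is the `L²` norm of its `0`-th derivative (private copy of a tree lemma).
[folklore] -/
private theorem lintegral_enorm_sq_eq_iteratedFDeriv_zero'
    (v : EuclideanSpace ℝ (Fin 3) → EuclideanSpace ℝ (Fin 3)) :
    ∫⁻ x, ‖v x‖ₑ ^ 2 = ∫⁻ x, ‖iteratedFDeriv ℝ 0 v x‖ₑ ^ 2 :=
  lintegral_congr fun x => by rw [← ofReal_norm, ← ofReal_norm, norm_iteratedFDeriv_zero]

section Main

variable {ν τ M : ℝ} {f u : ℝ → EuclideanSpace ℝ (Fin 3) → EuclideanSpace ℝ (Fin 3)}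
  {p : ℝ → EuclideanSpace ℝ (Fin 3) → ℝ}

/-- **Crossing the end of a slab (forced).** GIVEN Tao's forced local theory
`tao2011_smooth_local_existence_forced` (Tao 2013, Thm. 5.4 (ii)+(iv) with forcing — the ONLY
hypothesis that is not a theorem of the tree): a classical solution `(u, p)` of the Navier–Stokes
system with viscosity `ν > 0` and a Clay-class force `f` on the closed slab `[0, τ] × ℝ³`, `τ > 0`,
with finite energy, BOUNDED velocity (`‖u‖ ≤ M` on the slab) and a Schwartz datum `u(0)`, has a
classical finite-energy continuation with the same force to a slab `[0, T']`, `T' > τ`, agreeing with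
`(u, p)` (velocity AND pressure) on `[0, τ]`. Proof: RESTART LOOP — Tao's theorem from the `H^∞`
slices `u(t_n)`, `t_n = n h/2`, with a UNIFORM lifespan `h`: each restarted piece is the flow
itself (W14-free uniqueness under the flow's bound, `velocity_eq_of_bounded_classical`), so it is
bounded by `M` and the forced Serrin–Grönwall inequality at `r = ∞`
(`enstrophy_le_of_serrin_forced_uniform`) bounds the enstrophy of every slice `u(t_n)`,
`n h ≤ 2τ`, uniformly; the first piece reaching past `τ` is glued to `(u, p)`
(`IsClassicalNSSolutionOn.glue_Icc`) after matching the pressure gauge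
(`IsClassicalNSSolutionOn.exists_pressure_eq_on_Icc`). [cite: Tao2011, Thm. 5.4 (ii)+(iv)]
[cite: LemarieRieusset2016, Thm. 11.2 (11.11)] [cite: Sohr2001, Ch. V Thm. 1.5.1] -/
theorem exists_forced_continuation_of_bounded (hF : tao2011_smooth_local_existence_forced)
    (hν : 0 < ν) (hτ : 0 < τ) (hs : IsSmoothOnHalfSpace f) (hd : HasRapidSpaceTimeDecay f)
    (hu : IsClassicalNSSolutionOn (Icc 0 τ) ν f u p)
    (hE : ∃ C : ℝ≥0∞, C < ⊤ ∧ ∀ t ∈ Icc 0 τ, ∫⁻ x, ‖u t x‖ₑ ^ 2 ≤ C)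
    (hM : ∀ t ∈ Icc 0 τ, ∀ x, ‖u t x‖ ≤ M) (h0 : HasRapidSpatialDecay (u 0)) :
    ∃ T' : ℝ, τ < T' ∧
      ∃ (U : ℝ → EuclideanSpace ℝ (Fin 3) → EuclideanSpace ℝ (Fin 3))
        (P : ℝ → EuclideanSpace ℝ (Fin 3) → ℝ),
        IsClassicalNSSolutionOn (Icc 0 T') ν f U P ∧
        (∀ t ∈ Icc 0 τ, U t = u t ∧ P t = p t) ∧
        (∃ C : ℝ≥0∞, C < ⊤ ∧ ∀ t ∈ Icc 0 T', ∫⁻ x, ‖U t x‖ₑ ^ 2 ≤ C) := by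
  classical
  obtain ⟨c, hc, hloc⟩ := hF
  obtain ⟨C₀, C₁, B, hB0, hC₀, hC₁, hBf⟩ := exists_force_slice_bounds hs hd
  obtain ⟨E₀, hE₀, hEb⟩ := hE
  have hM0 : 0 ≤ M := le_trans (norm_nonneg _) (hM 0 ⟨le_rfl, hτ.le⟩ 0)
  -- the Serrin–Grönwall rate at `θ = 1`
  set κ : ℝ := 2 * ((1 : ℝ) * (2 * (1 - (1 : ℝ))) ^ ((1 - (1 : ℝ)) / 1) * (2 : ℝ) ^ (-(1 / (1 : ℝ))) *
      (SNormLESNormFDerivOfEqConst (EuclideanSpace ℝ (Fin 3))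
        (volume : Measure (EuclideanSpace ℝ (Fin 3))) 2 : ℝ) ^ (2 * (1 - (1 : ℝ)) / 1)) *
      (ν / 2) ^ (1 - 2 / (1 : ℝ)) with hκ
  have hκ0 : 0 ≤ κ := by
    have h0' : (0 : ℝ) ≤ (2 * (1 - (1 : ℝ))) ^ ((1 - (1 : ℝ)) / 1) := Real.rpow_nonneg (by norm_num) _
    have h1' : (0 : ℝ) ≤ (2 : ℝ) ^ (-(1 / (1 : ℝ))) := Real.rpow_nonneg (by norm_num) _
    have h2' : (0 : ℝ) ≤ (SNormLESNormFDerivOfEqConst (EuclideanSpace ℝ (Fin 3))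
        (volume : Measure (EuclideanSpace ℝ (Fin 3))) 2 : ℝ) ^ (2 * (1 - (1 : ℝ)) / 1) :=
      Real.rpow_nonneg (NNReal.coe_nonneg _) _
    have h3' : (0 : ℝ) ≤ (ν / 2) ^ (1 - 2 / (1 : ℝ)) := Real.rpow_nonneg (by positivity) _
    positivity
  -- initial enstrophy and the uniform enstrophy bound
  set K₀ : ℝ≥0∞ := ∫⁻ x, ENNReal.ofReal (frobeniusNormSq (fderiv ℝ (u 0) x)) with hK₀
  have hK₀t : K₀ < ⊤ :=
    (lintegral_frobeniusNormSq_le_three_mul_iteratedFDeriv_one (u 0)).trans_lt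
      (ENNReal.mul_lt_top (by simp) (h0.lintegral_enorm_iteratedFDeriv_sq_lt_top 1))
  set KS : ℝ≥0∞ := ENNReal.ofReal (Real.exp (κ * (M ^ 2 * (2 * τ)))) *
      (K₀ + (ENNReal.ofReal ν)⁻¹ * ((C₀ : ℝ≥0∞) * ENNReal.ofReal (2 * τ))) with hKS
  have hKSt : KS < ⊤ := by
    refine ENNReal.mul_lt_top ENNReal.ofReal_lt_top (ENNReal.add_lt_top.2 ⟨hK₀t, ?_⟩)
    refine ENNReal.mul_lt_top ?_ (ENNReal.mul_lt_top ENNReal.coe_lt_top ENNReal.ofReal_lt_top)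
    exact ENNReal.inv_lt_top.2 (ENNReal.ofReal_pos.2 hν)
  -- the uniform `H¹` radius `A` and the uniform lifespan `h`
  set A : ℝ := Real.sqrt (E₀ + KS).toReal with hA
  have hA0 : 0 ≤ A := Real.sqrt_nonneg _
  have hA2 : ENNReal.ofReal (A ^ 2) = E₀ + KS := by
    rw [hA, Real.sq_sqrt ENNReal.toReal_nonneg, ENNReal.ofReal_toReal]
    exact (ENNReal.add_lt_top.2 ⟨hE₀, hKSt⟩).ne
  set h : ℝ := min τ (min 1 (c * ν ^ 3 / (A + B + 1) ^ 4)) with hh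
  have hhτ : h ≤ τ := min_le_left _ _
  have hh1 : h ≤ 1 := (min_le_right _ _).trans (min_le_left _ _)
  have hhc : h ≤ c * ν ^ 3 / (A + B + 1) ^ 4 := (min_le_right _ _).trans (min_le_right _ _)
  have hhpos : 0 < h := lt_min hτ (lt_min one_pos (by positivity))
  have hsmall : (A + B * h) ^ 4 * h ≤ c * ν ^ 3 := by
    have h1 : A + B * h ≤ A + B + 1 := by nlinarith
    have h2 : 0 ≤ A + B * h := by positivity
    calc (A + B * h) ^ 4 * h ≤ (A + B + 1) ^ 4 * h :=
          mul_le_mul_of_nonneg_right (pow_le_pow_left₀ h2 h1 4) hhpos.le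
      _ ≤ (A + B + 1) ^ 4 * (c * ν ^ 3 / (A + B + 1) ^ 4) :=
          mul_le_mul_of_nonneg_left hhc (by positivity)
      _ = c * ν ^ 3 := by field_simp
  -- ONE PIECE from a good slice `u t₀`
  have piece : ∀ t₀, 0 ≤ t₀ → t₀ ≤ τ → (∀ m : ℕ, ∫⁻ x, ‖iteratedFDeriv ℝ m (u t₀) x‖ₑ ^ 2 < ⊤) →
      (∫⁻ x, ENNReal.ofReal (frobeniusNormSq (fderiv ℝ (u t₀) x))) ≤ KS →
      ∃ (w : ℝ → EuclideanSpace ℝ (Fin 3) → EuclideanSpace ℝ (Fin 3))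
        (q : ℝ → EuclideanSpace ℝ (Fin 3) → ℝ),
        IsClassicalNSSolutionOn (Icc 0 h) ν (fun s => f (s + t₀)) w q ∧ w 0 = u t₀ ∧
        HasBoundedSobolevNormsOn (Icc 0 h) w ∧
        HasBoundedSobolevNormsOn (Icc 0 h) (timeDerivWithin (Icc 0 h) w) ∧
        (∀ n : ℕ, ∃ C : ℝ≥0, ∀ t ∈ Icc 0 h, ∫⁻ x, ‖iteratedFDeriv ℝ n (q t) x‖ₑ ^ 2 ≤ C) := by
    intro t₀ ht₀ ht₀τ hHinf hens
    have hdat : (∫⁻ x, ‖u t₀ x‖ₑ ^ 2) +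
        (∫⁻ x, ENNReal.ofReal (frobeniusNormSq (fderiv ℝ (u t₀) x))) ≤ ENNReal.ofReal (A ^ 2) := by
      rw [hA2]; exact add_le_add (hEb t₀ ⟨ht₀, ht₀τ⟩) hens
    have hfB : ∀ t ∈ Icc 0 h, (∫⁻ x, ‖(fun s => f (s + t₀)) t x‖ₑ ^ 2) +
        (∫⁻ x, ENNReal.ofReal (frobeniusNormSq (fderiv ℝ ((fun s => f (s + t₀)) t) x))) ≤
          ENNReal.ofReal (B ^ 2) := fun t ht => hBf (t + t₀) (by linarith [ht.1])
    obtain ⟨w, q, hw, hw0, hwS, hwS', hqS, -⟩ := hloc hν hhpos (hu.contDiff_velocity ⟨ht₀, ht₀τ⟩)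
      (hu.divFree t₀ ⟨ht₀, ht₀τ⟩) hHinf (hs.isSmoothSpaceTimeOn_Icc_timeShift ht₀ h)
      (hd.hasUniformRapidDecayOn_Icc_timeShift hs ht₀ hhpos) hA0 hB0 hdat hfB hsmall
    exact ⟨w, q, hw, hw0, hwS, hwS', hqS⟩
  -- energy of a Tao-class piece
  have pieceE : ∀ {w : ℝ → EuclideanSpace ℝ (Fin 3) → EuclideanSpace ℝ (Fin 3)},
      HasBoundedSobolevNormsOn (Icc 0 h) w →
      ∃ C : ℝ≥0∞, C < ⊤ ∧ ∀ t ∈ Icc 0 h, ∫⁻ x, ‖w t x‖ₑ ^ 2 ≤ C := by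
    intro w hwS
    obtain ⟨C, hC⟩ := hwS 0
    exact ⟨C, ENNReal.coe_lt_top, fun t ht => by
      rw [lintegral_enorm_sq_eq_iteratedFDeriv_zero']; exact hC t ht⟩
  -- THE LOOP: the slices `u (n h/2)` are `H^∞` with controlled enstrophy while `n h/2 + h/2 ≤ τ`
  set bE : ℝ≥0∞ := (ENNReal.ofReal ν)⁻¹ * ((C₀ : ℝ≥0∞) * ENNReal.ofReal h) with hbE
  have loop : ∀ n : ℕ, (n : ℝ) * (h / 2) + h / 2 ≤ τ →
      (∀ m : ℕ, ∫⁻ x, ‖iteratedFDeriv ℝ m (u ((n : ℝ) * (h / 2))) x‖ₑ ^ 2 < ⊤) ∧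
      (∫⁻ x, ENNReal.ofReal (frobeniusNormSq (fderiv ℝ (u ((n : ℝ) * (h / 2))) x))) ≤
        ENNReal.ofReal (Real.exp (κ * (M ^ 2 * ((n : ℝ) * h)))) * (K₀ + (n : ℝ≥0∞) * bE) := by
    intro n
    induction n with
    | zero =>
      intro _
      refine ⟨fun m => ?_, ?_⟩
      · simpa using h0.lintegral_enorm_iteratedFDeriv_sq_lt_top (μ := (volume : Measure _)) m
      · simp [hK₀]
    | succ n ih =>
      intro hn1
      have htn : (n : ℝ) * (h / 2) + h ≤ τ := by push_cast at hn1; linarith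
      have htn0 : 0 ≤ (n : ℝ) * (h / 2) := by positivity
      obtain ⟨hH, hens⟩ := ih (by linarith)
      have hnh : (n : ℝ) * h ≤ 2 * τ := by linarith
      have hensKS : (∫⁻ x, ENNReal.ofReal (frobeniusNormSq (fderiv ℝ (u ((n : ℝ) * (h / 2))) x))) ≤
          KS := hens.trans (loop_bound_le_uniform hκ0 K₀ C₀ n hnh)
      obtain ⟨w, q, hw, hw0, hwS, hwS', hqS⟩ := piece _ htn0 (by linarith) hH hensKS
      -- the piece is the flow on `[0, h]`
      have heq : ∀ s ∈ Icc 0 h, w s = u (s + (n : ℝ) * (h / 2)) :=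
        piece_eq_shift hν hs hd hu ⟨E₀, hE₀, hEb⟩ hM htn0 hhpos htn le_rfl hw (pieceE hwS) hw0
      have hwM : ∀ t ∈ Icc 0 h, ∀ x, ‖w t x‖ ≤ M := fun t ht x => by
        rw [heq t ht]; exact hM _ ⟨by linarith [ht.1], by linarith [ht.2]⟩ x
      have hG := piece_enstrophy_le hν hC₀ hC₁ htn0 hhpos hM0 hw hwS hwS' hqS hwM (h / 2)
        ⟨by linarith, by linarith⟩
      have ht1 : (((n + 1 : ℕ) : ℝ) * (h / 2)) = h / 2 + (n : ℝ) * (h / 2) := by push_cast; ring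
      have hslice : u (((n + 1 : ℕ) : ℝ) * (h / 2)) = w (h / 2) := by
        rw [ht1, heq (h / 2) ⟨by linarith, by linarith⟩]
      refine ⟨fun m => ?_, ?_⟩
      · obtain ⟨C, hC⟩ := hwS m
        rw [hslice]
        exact (hC (h / 2) ⟨by linarith, by linarith⟩).trans_lt ENNReal.coe_lt_top
      · rw [hslice]
        refine hG.trans ?_
        rw [hw0]
        refine le_trans ?_ (loop_step_bound hκ0 hhpos.le K₀ bE n)
        gcongr
  -- the first piece that reaches past `τ`
  have hex : ∃ n : ℕ, τ < (n : ℝ) * (h / 2) + h := by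
    refine ⟨Nat.ceil (2 * τ / h) + 1, ?_⟩
    have h1 : 2 * τ / h ≤ (Nat.ceil (2 * τ / h) : ℝ) := Nat.le_ceil _
    have h2 : 2 * τ / h * (h / 2) = τ := by field_simp
    push_cast
    nlinarith
  set N := Nat.find hex with hN
  have hNspec : τ < (N : ℝ) * (h / 2) + h := Nat.find_spec hex
  have hNle : (N : ℝ) * (h / 2) + h / 2 ≤ τ := by
    rcases Nat.eq_zero_or_eq_succ_pred N with h0N | hsucc
    · rw [h0N]; simp; linarith
    · have hmin : ¬ (τ < ((N - 1 : ℕ) : ℝ) * (h / 2) + h) := Nat.find_min hex (by omega)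
      have hcast : (N : ℝ) = ((N - 1 : ℕ) : ℝ) + 1 := by
        rw [hsucc]; push_cast; simp
      rw [hcast]
      have hmin' := not_lt.1 hmin
      linarith
  set tN : ℝ := (N : ℝ) * (h / 2) with htN
  have htN0 : 0 ≤ tN := by positivity
  have htNτ : tN < τ := by linarith
  obtain ⟨hH, hens⟩ := loop N hNle
  have hnh : (N : ℝ) * h ≤ 2 * τ := by linarith
  obtain ⟨w, q, hw, hw0, hwS, hwS', hqS⟩ :=
    piece tN htN0 htNτ.le hH (hens.trans (loop_bound_le_uniform hκ0 K₀ C₀ N hnh))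
  -- identification with the flow on `[0, τ - tN]` and pressure matching
  set τ' : ℝ := τ - tN with hτ'
  have hτ'0 : 0 < τ' := by linarith
  have hτ'h : τ' ≤ h := by linarith
  have heq : ∀ s ∈ Icc 0 τ', w s = u (s + tN) :=
    piece_eq_shift hν hs hd hu ⟨E₀, hE₀, hEb⟩ hM htN0 hτ'0 (by linarith) hτ'h hw (pieceE hwS) hw0
  obtain ⟨q', hw', hq'⟩ := IsClassicalNSSolutionOn.exists_pressure_eq_on_Icc
    (shift_classical hu htN0 hτ'0 (by linarith)) hw hτ'0 hτ'h heq
  -- shift the piece back to `[tN, tN + h]`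
  set W : ℝ → EuclideanSpace ℝ (Fin 3) → EuclideanSpace ℝ (Fin 3) := fun t => w (t + -tN) with hW
  set Q : ℝ → EuclideanSpace ℝ (Fin 3) → ℝ := fun t => q' (t + -tN) with hQ
  have hWsol : IsClassicalNSSolutionOn (Icc tN (tN + h)) ν f W Q := by
    have h1 := (hw'.comp_add_right (-tN)).mono (S' := Icc tN (tN + h))
      (fun t ht => ⟨by linarith [ht.1], by linarith [ht.2]⟩) (uniqueDiffOn_Icc (by linarith))
    refine ⟨h1.smooth_velocity, h1.smooth_pressure, fun t ht x => ?_, h1.divFree⟩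
    have h2 := h1.momentum t ht x
    simp only [neg_add_cancel_right] at h2
    exact h2
  -- agreement with `(u, p)` on `[tN, τ]`
  have hagree : ∀ t ∈ Icc tN τ, u t = W t ∧ p t = Q t := by
    intro t ht
    have hmem : t + -tN ∈ Icc 0 τ' := ⟨by linarith [ht.1], by linarith [ht.2]⟩
    refine ⟨?_, ?_⟩
    · show u t = w (t + -tN)
      rw [heq _ hmem, neg_add_cancel_right]
    · show p t = q' (t + -tN)
      rw [hq' _ hmem, neg_add_cancel_right]
  -- glue
  set m : ℝ := (tN + τ) / 2 with hm
  have hglue := IsClassicalNSSolutionOn.glue_Icc hu hWsol htN0 (by linarith : tN < m)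
    (by linarith : m < τ) (by linarith : τ ≤ tN + h)
    (fun t ht => hagree t ⟨ht.1.le, ht.2.le⟩)
  obtain ⟨Cw, hCwt, hCw⟩ := pieceE hwS
  refine ⟨tN + h, by linarith, _, _, hglue, fun t ht => ?_, ⟨max E₀ Cw, max_lt hE₀ hCwt, fun t ht => ?_⟩⟩
  · by_cases htm : t ≤ m
    · exact ⟨if_pos htm, if_pos htm⟩
    · simp only [if_neg htm]
      have h := hagree t ⟨by linarith, ht.2⟩
      exact ⟨h.1.symm, h.2.symm⟩
  · by_cases htm : t ≤ m
    · simp only [if_pos htm]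
      exact (hEb t ⟨ht.1, by linarith⟩).trans (le_max_left _ _)
    · simp only [if_neg htm]
      show ∫⁻ x, ‖w (t + -tN) x‖ₑ ^ 2 ≤ max E₀ Cw
      exact (hCw (t + -tN) ⟨by linarith, by linarith [ht.2]⟩).trans (le_max_right _ _)

end Main

end ForcedContinuation

/-! ## §4 Registered stages cross the end of their slab; `LocalContinuationAt k` for every `k` -/

namespace Stage

variable {ν : ℝ} {R : TowerRates} {S : Schedule R} {m : Margins R} {k : ℕ}

/-- **Every stage continues under the design force past its slab** (GIVEN Tao's forced local
theory): a stage at level `k` of ANY schedule on ANY rates with ANY margins, at viscosity `ν > 0`, is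
a classical finite-energy solution on `[0, τ k]` with the schedule's Clay-class force, bounded by its
own level-`k` ceiling `c₂ Y_k`, from the schedule's Schwartz datum; so
`ForcedContinuation.exists_forced_continuation_of_bounded` continues it, velocity AND pressure
agreeing on `[0, τ k]`. [cite: Tao2011, Thm. 5.4 (ii)+(iv)] -/
theorem exists_forced_continuation (hF : tao2011_smooth_local_existence_forced) (hν : 0 < ν)
    (s : Stage ν R S m k) :
    ∃ T' : ℝ, S.τ k < T' ∧
      ∃ (U : ℝ → EuclideanSpace ℝ (Fin 3) → EuclideanSpace ℝ (Fin 3))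
        (P : ℝ → EuclideanSpace ℝ (Fin 3) → ℝ),
        IsClassicalNSSolutionOn (Icc 0 T') ν S.f U P ∧
        (∀ t ∈ Icc 0 (S.τ k), U t = s.u t ∧ P t = s.p t) ∧
        (∃ C : ℝ≥0∞, C < ⊤ ∧ ∀ t ∈ Icc 0 T', ∫⁻ x, ‖U t x‖ₑ ^ 2 ≤ C) := by
  have h0 : HasRapidSpatialDecay (s.u 0) := by rw [s.initial]; exact S.datum_decay
  exact ForcedContinuation.exists_forced_continuation_of_bounded hF hν (S.τ_pos k) S.force_smooth
    S.force_decay s.classical s.energy (s.ceiling k le_rfl) h0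

end Stage

/-- **`LocalContinuationAt k` for EVERY level `k`, GIVEN Tao's forced local theory** — in particular
at `k = 0` (the host crosses `τ₀` under the push) and `k = 1` (the level-1 flow crosses the end `τ₁`
of the forced era), where the tree's unforced continuation theory does not reach (ecbridge-7,
`localContinuationAt_of_two_le` covers `k ≥ 2` only). [cite: Tao2011, Thm. 5.4 (ii)+(iv)] -/
theorem localContinuationAt_of_forced_local_existence (hF : tao2011_smooth_local_existence_forced)
    (k : ℕ) : LocalContinuationAt k :=
  fun _ _ _ _ s => Stage.exists_forced_continuation hF one_pos s

/-- The upper half of the level-`k` heredity, `k ≥ 1`, GIVEN Tao's forced local theory, is the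
no-overshoot bet alone: `AprioriCeilingAt k → ContinuationEnvelopeAt k`
(`continuationEnvelopeAt_of_local_apriori`). [cite: Palasek2026ElementaryModel, §4] -/
theorem continuationEnvelopeAt_of_forced_apriori (hF : tao2011_smooth_local_existence_forced)
    {k : ℕ} (hk : 1 ≤ k) (hA : AprioriCeilingAt k) : ContinuationEnvelopeAt k :=
  continuationEnvelopeAt_of_local_apriori hk (localContinuationAt_of_forced_local_existence hF k) hA

/-- **Item 19249 modulo the named fact and the two physics stubs**:
`HeredityAtOne ⇐ tao2011_smooth_local_existence_forced ∧ AprioriCeilingAt 1 ∧ ReadoutFloorsAt 1`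
(`heredityAtOne_of_local_apriori_floors`). [cite: Palasek2026ElementaryModel, §4] -/
theorem heredityAtOne_of_forced_apriori_floors (hF : tao2011_smooth_local_existence_forced)
    (hA : AprioriCeilingAt 1) (hR : ReadoutFloorsAt 1) : HeredityAtOne :=
  heredityAtOne_of_local_apriori_floors (localContinuationAt_of_forced_local_existence hF 1) hA hR

end Summit.NavierStokesRegularity.FluidComputer.PalasekTowerClayBridge

end
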